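/-
Copyright (c) 2026 the pub-hodgecm-mathlib formalisation cell (harness21).  Prover seat hodgecm-mathlib-LH4-p07 (g8), req620 Track A «(D-RAM) FOUR-FRAME» squad
(STAGE-1b pre-scoping, heir LEAD F0P3a-plan (g20∕g21) T19-24 clause; dealer LH4-plan (g12∕g13) WORD #36 «p07 (g8): row-(2) lead»), 2026-09-04.
-/
import Summits.HodgeConjecture.HodgeConjecture.Theorems.F0P3cDyRamOrderFiltrationRange   -- ★ (α) `isOrd_pow_iff_le`; brings ★ DEFS `IsOrd`
import HarnessLib

/-!
# Crux `H413`, line LH4 «(D-RAM) FOUR-FRAME» — STAGE-1b, row (2): (C1-P^{a,b}) INDICATOR LETTER «THE AXIS ∕ CONE INDICATOR OF THE JOINT PROFILE CENSUS IN γ'S TOKENS»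
# `[(lam − 1)∕c ∈ 𝒪_j] = [j ≤ jλ − a]`, `[(lam − 1)²∕c′ ∈ 𝒪_j] = [j ≤ jλ + n − b]`  (`|c| = |ϖE|^a`, `|c′| = |ϖE|^b`, `|lam − ρlam| = |ϖE|^{jλ}|α − ρα|`, `|lam + ρlam − 2| = |ϖE|^n`)

Cell `hodgecm-mathlib` (D-0151), FLOOR 0, crux item H413 = `stmt-HodgeConjecture-24833`, route of record `HCCMUnconditional`; squad F0∕P3c∕LH4; lane
`--supports stmt-HodgeConjecture-24833 --as helper` (count-neutral; pays NO tier-0 row).  THEOREMS ONLY (no `def`, no instance, no notation, no `sorry`).  Type-free field algebra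
(`K` valued, `ρ : K →+* K` isometric, `α` with `ρα ≠ α`, `c, c′` `ρ`-fixed — in the censuses `c = jE ϖ^a`, `c′ = jE ϖ^b`).

THE POINT.  The order-form censuses of the template pieces `lev_{a,m}` (★ p859229; guarded ★ p859278 ∕ p859305) carry the indicator
`[IsOrd_j lam ∧ IsOrd_j (c⁻¹(lam − 1)) ∧ IsOrd_j (c′⁻¹(lam − 1)²)]` on the axis term `Σ_j [·]·#levelSet(j, 0)` and on every cone stratum.  In `γ`'s tokens:
`c⁻¹(lam − 1) − ρ(c⁻¹(lam − 1)) = c⁻¹(lam − ρlam)` and `(lam − 1)² − ρ(lam − 1)² = (lam − ρlam)·(lam + ρlam − 2)`, so by ★ (α) `isOrd_pow_iff_le` each clause is a TRUNCATION of `j`: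
`IsOrd_j (c⁻¹(lam − 1)) ⟺ j ≤ jλ − a` (under the level condition `|lam − 1| ≤ |c|`, else never) and `IsOrd_j (c′⁻¹(lam − 1)²) ⟺ j ≤ jλ + n − b` (under `|lam − 1|² ≤ |c′|`, else never), with
`n` the value token of `lam + ρlam − 2` — the AXIS TERM of the `lev_{a,m}` census is `Σ_{j ≤ min(jλ, jλ − a, jλ + n − b)} #levelSet(j, 0)`, which ★ T5's `a = 0` rows evaluate per third-field type.
* `inv_mul_sub_map_inv_mul`, `sub_one_mul_sub_one_sub_map` (the two factorisations); `v_inv_mul_sub_one_sub_map_eq`, `v_sub_one_sq_sub_map_eq` (twist values);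
  `not_isOrd_inv_mul_of_lt` (level condition violated ⇒ indicator `0`); `isOrd_pow_inv_mul_sub_one_iff_le`, `isOrd_pow_inv_mul_sub_one_sq_iff_le` (THE INDICATOR LETTERS).
HONEST LABEL.  Count-neutral algebra; nothing printed is asserted; no census law is stated; `HC_CM` is proved only modulo the 7 printed citations (2 remaining named inputs:
hLiu418 = `stmt-HodgeConjecture-24832`, h413 = `stmt-HodgeConjecture-24833`) until rung 0 closes.

## References
* [Kottwitz1986BaseChangeUnits] R. E. Kottwitz, *Base change for unit elements of Hecke algebras*, Compositio Math. 60 (1986): §1 pp. 240–241.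
* [Serre1979] J.-P. Serre, *Local Fields*, GTM 67 (1979): Ch. II §1; Ch. III §6 Prop. 12 (orders of conductor `c`).
* [Flicker1998UnitaryFL] Y. Z. Flicker, *Elementary proof of the fundamental lemma for a unitary group*, Canad. J. Math. 50 (1998): p. 84 REMARK.
-/

set_option autoImplicit false

noncomputable section

open scoped Valued WithZero
open WithZero
open Summit.HodgeConjecture.HodgeConjecture.Cruxes.H413.F0P3cDyRamToricCensusDefs
open Summit.HodgeConjecture.HodgeConjecture.Cruxes.H413.F0P3cDyRamOrderFiltrationRange

namespace Summit.HodgeConjecture.HodgeConjecture.Cruxes.H413.F0P3cDyRamJointProfileCensusIndicatorLetter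

variable {K : Type*} [Field K] [Valued K ℤᵐ⁰] {ρ : K →+* K} {α : K}

/-! ## §1 The two factorisations and the twist values -/

omit [Valued K ℤᵐ⁰] in
/-- `c⁻¹z − ρ(c⁻¹z) = c⁻¹(z − ρz)` for `ρ`-fixed `c`. [cite: Serre1979, Ch. III §6 Prop. 12] -/
theorem inv_mul_sub_map_inv_mul {c : K} (hρc : ρ c = c) (z : K) : c⁻¹ * z - ρ (c⁻¹ * z) = c⁻¹ * (z - ρ z) := by
  rw [map_mul, map_inv₀, hρc]; ring

omit [Valued K ℤᵐ⁰] in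
/-- `(lam − 1)² − ρ(lam − 1)² = (lam − ρlam)·(lam + ρlam − 2)`. [cite: Flicker1998UnitaryFL, p. 84 REMARK] -/
theorem sub_one_mul_sub_one_sub_map (lam : K) :
    (lam - 1) * (lam - 1) - ρ ((lam - 1) * (lam - 1)) = (lam - ρ lam) * (lam + ρ lam - 2) := by
  rw [map_mul, map_sub, map_one]; ring

/-- **TWIST VALUE OF THE DEPTH MULTIPLIER'S INDICATOR ELEMENT**: `|c⁻¹(lam − 1) − ρ(c⁻¹(lam − 1))| = |lam − ρlam| ∕ |c|`. [cite: Serre1979, Ch. II §1] -/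
theorem v_inv_mul_sub_one_sub_map_eq {c : K} (hρc : ρ c = c) (lam : K) :
    Valued.v (c⁻¹ * (lam - 1) - ρ (c⁻¹ * (lam - 1))) = Valued.v (lam - ρ lam) / Valued.v c := by
  rw [inv_mul_sub_map_inv_mul hρc, show lam - 1 - ρ (lam - 1) = lam - ρ lam by rw [map_sub, map_one]; ring, map_mul, map_inv₀,
    div_eq_inv_mul]

/-- **TWIST VALUE OF THE SQUARE MULTIPLIER'S INDICATOR ELEMENT**: `|c′⁻¹(lam − 1)² − ρ(c′⁻¹(lam − 1)²)| = |lam − ρlam|·|lam + ρlam − 2| ∕ |c′|`. [cite: Serre1979, Ch. II §1] -/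
theorem v_sub_one_sq_sub_map_eq {c' : K} (hρc' : ρ c' = c') (lam : K) :
    Valued.v (c'⁻¹ * ((lam - 1) * (lam - 1)) - ρ (c'⁻¹ * ((lam - 1) * (lam - 1)))) = Valued.v (lam - ρ lam) * Valued.v (lam + ρ lam - 2) / Valued.v c' := by
  rw [inv_mul_sub_map_inv_mul hρc', sub_one_mul_sub_one_sub_map, map_mul, map_mul, map_inv₀, div_eq_inv_mul]

/-! ## §2 The indicator letters -/

/-- **LEVEL CONDITION VIOLATED ⇒ INDICATOR `0`**: if `|c| < |z|` then `c⁻¹z ∉ 𝒪_{c″}` for every conductor `c″` (`|c⁻¹z| > 1`). [cite: Serre1979, Ch. III §6 Prop. 12] -/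
theorem not_isOrd_inv_mul_of_lt {c z : K} (hc : c ≠ 0) (hlt : Valued.v c < Valued.v z) (c'' : K) : ¬ IsOrd ρ α c'' (c⁻¹ * z) := by
  intro h
  have h1 := h.1
  rw [map_mul, map_inv₀] at h1
  have hc0 : 0 < Valued.v c := zero_lt_iff.2 ((Valuation.ne_zero_iff _).2 hc)
  have : Valued.v z ≤ Valued.v c := by
    have := mul_le_mul_of_nonneg_left h1 hc0.le
    rwa [mul_one, ← mul_assoc, mul_inv_cancel₀ hc0.ne', one_mul] at this
  exact not_lt.2 this hlt

/-- **THE DEPTH INDICATOR LETTER**: for `ρα ≠ α`, `ϖE` with `0 < |ϖE| < 1`, `c` `ρ`-fixed with `|c| = |ϖE|^a`, `|lam − 1| ≤ |c|` (the level condition) and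
`|lam − ρlam| = |ϖE|^{jλ}·|α − ρα|` with `a ≤ jλ`: `IsOrd ρ α (ϖE^j) (c⁻¹(lam − 1)) ⟺ j ≤ jλ − a` — ★ (α) `isOrd_pow_iff_le` at the element `c⁻¹(lam − 1)`, whose twist value is
`|ϖE|^{jλ − a}·|α − ρα|` (§1). [cite: Kottwitz1986BaseChangeUnits, §1 pp. 240–241] [cite: Flicker1998UnitaryFL, p. 84 REMARK] -/
theorem isOrd_pow_inv_mul_sub_one_iff_le (hα : ρ α ≠ α) {ϖE : K} (hϖ0 : ϖE ≠ 0) (hϖ1 : Valued.v ϖE < 1) {c : K} (hρc : ρ c = c) {a : ℕ}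
    (hc : Valued.v c = Valued.v ϖE ^ a) {lam : K} (hlev : Valued.v (lam - 1) ≤ Valued.v c) {jl : ℕ}
    (hjl : Valued.v (lam - ρ lam) = Valued.v ϖE ^ jl * Valued.v (α - ρ α)) (hajl : a ≤ jl) (j : ℕ) :
    IsOrd ρ α (ϖE ^ j) (c⁻¹ * (lam - 1)) ↔ j ≤ jl - a := by
  have hvϖ : Valued.v ϖE ≠ 0 := (Valuation.ne_zero_iff _).2 hϖ0
  have hvc : Valued.v c ≠ 0 := by rw [hc]; exact pow_ne_zero _ hvϖ
  have hc0 : c ≠ 0 := fun h0 => hvc (by rw [h0, map_zero])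
  have h1 : Valued.v (c⁻¹ * (lam - 1)) ≤ 1 := by
    rw [map_mul, map_inv₀]
    calc (Valued.v c)⁻¹ * Valued.v (lam - 1) ≤ (Valued.v c)⁻¹ * Valued.v c := mul_le_mul_of_nonneg_left hlev zero_le
      _ = 1 := inv_mul_cancel₀ hvc
  have hpow : Valued.v ϖE ^ jl = Valued.v ϖE ^ (jl - a) * Valued.v ϖE ^ a := by rw [← pow_add, Nat.sub_add_cancel hajl]
  have h2 : Valued.v (c⁻¹ * (lam - 1) - ρ (c⁻¹ * (lam - 1))) = Valued.v ϖE ^ (jl - a) * Valued.v (α - ρ α) := by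
    rw [v_inv_mul_sub_one_sub_map_eq hρc, hjl, hc, div_eq_iff (pow_ne_zero _ hvϖ), hpow, mul_right_comm]
  exact isOrd_pow_iff_le hα hϖ0 hϖ1 h1 h2 j

/-- **THE SQUARE INDICATOR LETTER**: for `ρα ≠ α`, `0 < |ϖE| < 1`, `c′` `ρ`-fixed with `|c′| = |ϖE|^b`, `|lam − 1|² ≤ |c′|` (the square level condition),
`|lam − ρlam| = |ϖE|^{jλ}·|α − ρα|`, `|lam + ρlam − 2| = |ϖE|^n` and `b ≤ jλ + n`: `IsOrd ρ α (ϖE^j) (c′⁻¹(lam − 1)²) ⟺ j ≤ jλ + n − b` — ★ (α) at the element `c′⁻¹(lam − 1)²`, whose twist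
value is `|ϖE|^{jλ + n − b}·|α − ρα|` (§1). [cite: Kottwitz1986BaseChangeUnits, §1 pp. 240–241] [cite: Flicker1998UnitaryFL, p. 84 REMARK] -/
theorem isOrd_pow_inv_mul_sub_one_sq_iff_le (hα : ρ α ≠ α) {ϖE : K} (hϖ0 : ϖE ≠ 0) (hϖ1 : Valued.v ϖE < 1) {c' : K} (hρc' : ρ c' = c') {b : ℕ}
    (hc' : Valued.v c' = Valued.v ϖE ^ b) {lam : K} (hlev : Valued.v ((lam - 1) * (lam - 1)) ≤ Valued.v c') {jl n : ℕ}
    (hjl : Valued.v (lam - ρ lam) = Valued.v ϖE ^ jl * Valued.v (α - ρ α)) (hn : Valued.v (lam + ρ lam - 2) = Valued.v ϖE ^ n) (hb : b ≤ jl + n) (j : ℕ) :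
    IsOrd ρ α (ϖE ^ j) (c'⁻¹ * ((lam - 1) * (lam - 1))) ↔ j ≤ jl + n - b := by
  have hvϖ : Valued.v ϖE ≠ 0 := (Valuation.ne_zero_iff _).2 hϖ0
  have hvc : Valued.v c' ≠ 0 := by rw [hc']; exact pow_ne_zero _ hvϖ
  have hc0 : c' ≠ 0 := fun h0 => hvc (by rw [h0, map_zero])
  have h1 : Valued.v (c'⁻¹ * ((lam - 1) * (lam - 1))) ≤ 1 := by
    rw [map_mul, map_inv₀]
    calc (Valued.v c')⁻¹ * Valued.v ((lam - 1) * (lam - 1)) ≤ (Valued.v c')⁻¹ * Valued.v c' := mul_le_mul_of_nonneg_left hlev zero_le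
      _ = 1 := inv_mul_cancel₀ hvc
  have hpow : Valued.v ϖE ^ jl * Valued.v ϖE ^ n = Valued.v ϖE ^ (jl + n - b) * Valued.v ϖE ^ b := by
    rw [← pow_add, ← pow_add, Nat.sub_add_cancel hb]
  have h2 : Valued.v (c'⁻¹ * ((lam - 1) * (lam - 1)) - ρ (c'⁻¹ * ((lam - 1) * (lam - 1)))) = Valued.v ϖE ^ (jl + n - b) * Valued.v (α - ρ α) := by
    rw [v_sub_one_sq_sub_map_eq hρc', hjl, hn, hc', div_eq_iff (pow_ne_zero _ hvϖ)]
    calc Valued.v ϖE ^ jl * Valued.v (α - ρ α) * Valued.v ϖE ^ n = (Valued.v ϖE ^ jl * Valued.v ϖE ^ n) * Valued.v (α - ρ α) := mul_right_comm _ _ _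
      _ = (Valued.v ϖE ^ (jl + n - b) * Valued.v ϖE ^ b) * Valued.v (α - ρ α) := by rw [hpow]
      _ = Valued.v ϖE ^ (jl + n - b) * Valued.v (α - ρ α) * Valued.v ϖE ^ b := mul_right_comm _ _ _
  exact isOrd_pow_iff_le hα hϖ0 hϖ1 h1 h2 j

end Summit.HodgeConjecture.HodgeConjecture.Cruxes.H413.F0P3cDyRamJointProfileCensusIndicatorLetter

end
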